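import Summits.BirchSwinnertonDyer.Rank1Residual.X5.TwoAdicKobayashiUnits
import Mathlib.NumberTheory.Padics.PadicNumbers
import Mathlib.Analysis.SpecificLimits.Normed
import Mathlib.Algebra.Polynomial.Coeff
import Mathlib.Tactic
import HarnessLib

/-!
# Class O1 (X5, `p = 2`, non-CM): LEMMA K₂♮ — the `2`-adic CONVERGENCE of Kobayashi's logarithm
# `h = ℓ₂ − log(1+X)` coefficientwise, the limit `h ∈ ℚ₂⟦X⟧` as an honest definition, and the
# refuter's coefficient check `[X²] h = −1` (typer queue v3.16 item (30), part 2 of 2)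

HONEST FRAMING (cell `b2b-bsdres`, run/shared/lean/b2b/bsd-rank1-residual/, verbatim in every
file): the goal of the cell is to DELETE the COMBINATION-SHAPED residual classes of the
Birch–Swinnerton-Dyer formula for ALL analytic-rank `≤ 1` elliptic curves over `ℚ` — "full BSD
formula for every rank `≤ 1` curve in class `C`" assembled STRICTLY from published theorems — so
that the rank-`≤ 1` remainder becomes exactly the CONSTRUCTION-SHAPED classes, which are TYPED
(missing-input `Prop`s), NOT attempted. This is not "finishing BSD". Research routes; no claim
beyond stated classes; census output = EVIDENCE, never a Literature fact; nothing here is booked;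
no mark of RESIDUAL-MAP §I moves.

Unit `b2b-bsdres-cc-typer-4` (lane CLASS-CLOSURE, class O1), gen 8; o1 lead PLAN §33 C199 (e) item
(30) "size M / L (2-adic convergence of `h` in `PowerSeries`)"; the typer's feasibility note (ii)
(INBOX 2026-08-21T18:38Z). Companion of `X5/TwoAdicKobayashiUnits.lean` (S3 at every finite level
in the unit variable + the torsion dictionary). THEOREMS + three `def`s with bodies (no instance declared); 0 named facts;
records-grade; no door effect; KIM₂ door price and R-G21.2 (ii) "not in print at `p = 2`" UNCHANGED.

## What is typed

[Kobayashi 2006, §2 p. 569]: "This power series [`ℓ(X) = log(1+X) + Σ_{k≥0} Σ_{δ∈Δ}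
((X+1)^{p^kδ} − 1)/p^k`] is convergent in `ℚ_p⟦X⟧` due to the summation `Σ_{δ∈Δ}`." At `p = 2`,
`Δ = {±1}` (lens-3 (G19.2); refuter §104 (k2): "the k-sum converges 2-adically iff `Σ_δ δ = 0`,
i.e. `Δ = {±1}`") the `k`-th `δ`-paired summand at `u = 1 + X` is
`t_k(1+X) = 2^{−k}·N_k`, `N_k := ((1+X)^{2^k} − 1)²·(1+X)^{−2^k} ∈ ℤ⟦X⟧` (`kobNumer`; cf.
`KobayashiTwo.kobTerm_eq_sq_mul`). PROVED here:
* (§1, over `ℤ`) **`2^{2k} ∣ (m!)²·[X^m] N_k`** (`two_pow_dvd_factorial_sq_mul_coeff_kobNumer`) — from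
  Kummer's `m·C(2^k, m) = 2^k·C(2^k − 1, m − 1)` applied to both factors `(1+X)^{2^k} − 1`; hence
  `v₂([X^m] t_k(1+X)) ≥ k − 2·v₂(m!) → ∞`: the coefficientwise `2`-adic convergence of `Σ_k t_k`;
* (§2, over `ℚ₂`) the norm bound `‖[X^m] t_k‖₂ ≤ ‖(m!)²‖₂^{−1}·2^{−k}` (`norm_kobCoeff_le`),
  summability in `k` (`summable_kobCoeff`), the LIMIT **`kobLogSeries : ℚ₂⟦X⟧`**,
  `[X^m] kobLogSeries := Σ_{k≥0} [X^m] t_k(1+X)` (a `tsum`, with its `HasSum`), and the statement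
  that the truncations of the companion file converge to it coefficientwise:
  `[X^m] h_K(1+X) → [X^m] kobLogSeries` as `K → ∞` (`tendsto_coeff_kobLog_onePlusX`);
* (§3) the first coefficients: `[X⁰] = [X¹] = 0` and **`[X²] kobLogSeries = −1`**
  (`coeff_two_kobLogSeries`: `[X²] t_k(1+X) = 2^k` and `Σ_k 2^k = (1−2)^{−1} = −1` in `ℚ₂`) — the
  refuter's (k4) check "the `X²`-coefficient of `ℓ₂` is `−3/2`" minus `[X²] log(1+X) = −1/2`; over
  `ℚ` the same coefficient of `h_K` is `2^K − 1 → ∞`: the convergence is `2`-adic, not archimedean.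
NOT typed: `G₂ := e⁴·exp(kobLogSeries)` (definable via `PowerSeries.exp`/`PowerSeries.subst`; no
property of it is provable here without the Honda/Hazewinkel integrality import), the
multiplicative Coleman identity, `U¹_n`, Prop. 2.1 (ii)₂ / 2.2₂ (see the companion file's docstring).

References: [Kobayashi2006DocMath] §2 p. 569; lens-3 GEN 19 (G19.2); o1 refuter v14b §104 (k2), (k4).
-/

set_option autoImplicit false

namespace Summit.BirchSwinnertonDyer.Rank1Residual.X5.O1

namespace KobayashiTwo

open PowerSeries

/-! ## §1. The integer numerators `N_k = ((1+X)^{2^k} − 1)²·(1+X)^{−2^k}` and Kummer's divisibility -/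

section Integer

/-- **`N_k := ((1+X)^{2^k} − 1)² · ((1+X)^{2^k})⁻¹ ∈ ℤ⟦X⟧`**, the integer numerator of the `k`-th
`δ`-paired summand `t_k(1+X) = 2^{−k} N_k` of `h = ℓ₂ − log(1+X)` ([Kobayashi 2006, §2 p. 568] `ℓ`
at `p = 2`, `Δ = {±1}`; `KobayashiTwo.kobTerm_eq_sq_mul`). The inverse is Mathlib's
`PowerSeries.invOfUnit`. [cite: Kobayashi2006DocMath, §2 p. 568] -/
noncomputable def kobNumer (k : ℕ) : ℤ⟦X⟧ :=
  ((1 + X) ^ 2 ^ k - 1) ^ 2 * PowerSeries.invOfUnit ((1 + X) ^ 2 ^ k) 1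

/-- `(1+X)^{2^k} · ((1+X)^{2^k})⁻¹ = 1` in `ℤ⟦X⟧`. [folklore] -/
theorem one_add_X_pow_mul_invOfUnit (k : ℕ) :
    ((1 + X : ℤ⟦X⟧) ^ 2 ^ k) * PowerSeries.invOfUnit ((1 + X : ℤ⟦X⟧) ^ 2 ^ k) 1 = 1 :=
  PowerSeries.mul_invOfUnit _ _ (by simp)

/-- The coefficients of `(1+X)^{2^k} − 1`: `0` in degree `0`, the binomial `C(2^k, m)` in degree
`m ≥ 1`. [folklore] -/
theorem coeff_one_add_X_pow_sub_one (k m : ℕ) :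
    coeff m ((1 + X : ℤ⟦X⟧) ^ 2 ^ k - 1) = if m = 0 then 0 else ((2 ^ k).choose m : ℤ) := by
  have h : ((1 + X : ℤ⟦X⟧) ^ 2 ^ k) = (((1 + Polynomial.X) ^ 2 ^ k : Polynomial ℤ) : ℤ⟦X⟧) := by
    rw [Polynomial.coe_pow, Polynomial.coe_add, Polynomial.coe_one, Polynomial.coe_X]
  rw [map_sub, h, Polynomial.coeff_coe, Polynomial.coeff_one_add_X_pow]
  split_ifs with hm
  · subst hm; simp
  · rw [coeff_one, if_neg hm, sub_zero]

/-- **Kummer at a power of `2`**: `2^k ∣ m · C(2^k, m)` (`m·C(2^k,m) = 2^k·C(2^k−1,m−1)`). [folklore] -/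
theorem two_pow_dvd_mul_choose (k m : ℕ) : 2 ^ k ∣ m * (2 ^ k).choose m := by
  rcases Nat.eq_zero_or_pos m with rfl | hm
  · simp
  · have h := Nat.add_one_mul_choose_eq (2 ^ k - 1) (m - 1)
    rw [Nat.sub_add_cancel Nat.one_le_two_pow, Nat.sub_add_cancel hm] at h
    exact ⟨(2 ^ k - 1).choose (m - 1), by rw [mul_comm, ← h]⟩

/-- `2^k ∣ m!·[X^a]((1+X)^{2^k} − 1)` for every `a ≤ m`. [folklore] -/
theorem two_pow_dvd_factorial_mul_coeff (k m a : ℕ) (ha : a ≤ m) :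
    (2 : ℤ) ^ k ∣ (m.factorial : ℤ) * coeff a ((1 + X : ℤ⟦X⟧) ^ 2 ^ k - 1) := by
  rw [coeff_one_add_X_pow_sub_one]
  split_ifs with h0
  · simp
  · obtain ⟨q, hq⟩ := Nat.dvd_factorial (Nat.pos_of_ne_zero h0) ha
    obtain ⟨r, hr⟩ := two_pow_dvd_mul_choose k a
    refine ⟨(q : ℤ) * r, ?_⟩
    have : (m.factorial : ℤ) * ((2 ^ k).choose a : ℤ) = (q : ℤ) * ((a * (2 ^ k).choose a : ℕ) : ℤ) := by
      rw [hq]; push_cast; ring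
    rw [this, hr]; push_cast; ring

/-- **The divisibility behind the `2`-adic convergence**: `2^{2k} ∣ (m!)²·[X^m] N_k` for all
`m, k` — so `v₂([X^m] t_k(1+X)) = v₂([X^m] N_k) − k ≥ k − 2 v₂(m!) → ∞` as `k → ∞` for fixed `m`:
the `p = 2` content of [Kobayashi 2006, §2 p. 569] "convergent in `ℚ_p⟦X⟧` due to the summation
`Σ_{δ∈Δ}`" (refuter §104 (k2)). [cite: Kobayashi2006DocMath, §2 p. 569] -/
theorem two_pow_dvd_factorial_sq_mul_coeff_kobNumer (k m : ℕ) :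
    (2 : ℤ) ^ (2 * k) ∣ (m.factorial : ℤ) ^ 2 * coeff m (kobNumer k) := by
  set P : ℤ⟦X⟧ := (1 + X : ℤ⟦X⟧) ^ 2 ^ k - 1 with hP
  set V : ℤ⟦X⟧ := PowerSeries.invOfUnit ((1 + X : ℤ⟦X⟧) ^ 2 ^ k) 1 with hV
  have hN : kobNumer k = P * (P * V) := by rw [kobNumer, sq, mul_assoc]
  rw [hN, coeff_mul, Finset.mul_sum]
  refine Finset.dvd_sum fun x hx => ?_
  rw [coeff_mul, Finset.mul_sum, Finset.mul_sum]
  refine Finset.dvd_sum fun y hy => ?_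
  have hx1 : x.1 ≤ m := Finset.HasAntidiagonal.antidiagonal.fst_le hx
  have hy1 : y.1 ≤ m :=
    (Finset.HasAntidiagonal.antidiagonal.fst_le hy).trans
      (Finset.HasAntidiagonal.antidiagonal.snd_le hx)
  have h1 := two_pow_dvd_factorial_mul_coeff k m x.1 hx1
  have h2 := two_pow_dvd_factorial_mul_coeff k m y.1 hy1
  have : (m.factorial : ℤ) ^ 2 * (coeff x.1 P * (coeff y.1 P * coeff y.2 V)) =
      ((m.factorial : ℤ) * coeff x.1 P) * (((m.factorial : ℤ) * coeff y.1 P) * coeff y.2 V) := by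
    ring
  rw [this, two_mul, pow_add]
  exact mul_dvd_mul h1 (h2.mul_right _)

/-- `(1+X)^{2^k} − 1 = X · P′` with `[X⁰] P′ = 2^k`: no constant term, linear coefficient `2^k`.
[folklore] -/
theorem one_add_X_pow_sub_one_eq_X_mul (k : ℕ) :
    ((1 + X : ℤ⟦X⟧) ^ 2 ^ k - 1) =
      X * PowerSeries.mk fun p => coeff (p + 1) ((1 + X : ℤ⟦X⟧) ^ 2 ^ k - 1) := by
  have h := eq_X_mul_shift_add_const ((1 + X : ℤ⟦X⟧) ^ 2 ^ k - 1)
  have h0 : constantCoeff ((1 + X : ℤ⟦X⟧) ^ 2 ^ k - 1) = 0 := by simp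
  rw [h0, map_zero, add_zero] at h
  exact h

/-- The first coefficients of `N_k`: `[X⁰] N_k = [X¹] N_k = 0` and `[X²] N_k = 2^{2k}` (from
`N_k = X²·(P′² V)`, `P′(0) = 2^k`, `V(0) = 1`). [folklore] -/
theorem coeff_kobNumer_low (k : ℕ) :
    coeff 0 (kobNumer k) = 0 ∧ coeff 1 (kobNumer k) = 0 ∧ coeff 2 (kobNumer k) = 2 ^ (2 * k) := by
  set P' : ℤ⟦X⟧ := PowerSeries.mk fun p => coeff (p + 1) ((1 + X : ℤ⟦X⟧) ^ 2 ^ k - 1) with hP'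
  set V : ℤ⟦X⟧ := PowerSeries.invOfUnit ((1 + X : ℤ⟦X⟧) ^ 2 ^ k) 1 with hV
  have hN : kobNumer k = X ^ 2 * (P' ^ 2 * V) := by
    rw [kobNumer, one_add_X_pow_sub_one_eq_X_mul]; ring
  have hP'0 : constantCoeff P' = 2 ^ k := by
    rw [hP', ← coeff_zero_eq_constantCoeff_apply, coeff_mk, zero_add, coeff_one_add_X_pow_sub_one,
      if_neg one_ne_zero, Nat.choose_one_right]
    push_cast; rfl
  have hV0 : constantCoeff V = 1 := by
    rw [hV, PowerSeries.constantCoeff_invOfUnit, inv_one, Units.val_one]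
  refine ⟨?_, ?_, ?_⟩
  · rw [hN, coeff_X_pow_mul']; simp
  · rw [hN, coeff_X_pow_mul']; simp
  · rw [hN, show (2 : ℕ) = 0 + 2 from rfl, coeff_X_pow_mul, coeff_zero_eq_constantCoeff_apply,
      map_mul, map_pow, hP'0, hV0, mul_one, ← pow_mul, mul_comm]

end Integer

/-! ## §2. The `2`-adic limit `h ∈ ℚ₂⟦X⟧` -/

section TwoAdic

/-- **`[X^m] t_k(1+X) ∈ ℚ₂`**: the `m`-th coefficient `2^{−k}·[X^m] N_k` of the `k`-th `δ`-paired
summand of `h = ℓ₂ − log(1+X)`, read in `ℚ₂`. [cite: Kobayashi2006DocMath, §2 p. 568] -/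
noncomputable def kobCoeff (m k : ℕ) : ℚ_[2] :=
  (2 : ℚ_[2])⁻¹ ^ k * ((coeff m (kobNumer k) : ℤ) : ℚ_[2])

/-- **The norm bound**: `‖[X^m] t_k(1+X)‖₂ ≤ ‖(m!)²‖₂⁻¹ · 2^{−k}` (from
`two_pow_dvd_factorial_sq_mul_coeff_kobNumer`). [cite: Kobayashi2006DocMath, §2 p. 569] -/
theorem norm_kobCoeff_le (m k : ℕ) :
    ‖kobCoeff m k‖ ≤ ‖((m.factorial : ℚ_[2])) ^ 2‖⁻¹ * (2⁻¹ : ℝ) ^ k := by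
  obtain ⟨q, hq⟩ := two_pow_dvd_factorial_sq_mul_coeff_kobNumer k m
  -- `‖2‖₂ = 1/2` (the tree's `Rank2Observatory.padic_norm_two`, re-derived inline from `Padic.norm_p`)
  have norm_two_padic : ‖(2 : ℚ_[2])‖ = 2⁻¹ := by
    have h := Padic.norm_p (p := 2)
    norm_num at h ⊢
    exact h
  have hfac : ((m.factorial : ℚ_[2])) ^ 2 ≠ 0 :=
    pow_ne_zero _ (Nat.cast_ne_zero.2 (Nat.factorial_ne_zero m))
  have hfpos : 0 < ‖((m.factorial : ℚ_[2])) ^ 2‖ := norm_pos_iff.2 hfac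
  -- `‖(m!)²‖ · ‖c‖ = ‖2^{2k} q‖ ≤ 2^{-2k}`
  have hc : ‖((m.factorial : ℚ_[2])) ^ 2‖ * ‖((coeff m (kobNumer k) : ℤ) : ℚ_[2])‖ ≤
      (2⁻¹ : ℝ) ^ (2 * k) := by
    rw [← norm_mul]
    have hcast : ((m.factorial : ℚ_[2])) ^ 2 * ((coeff m (kobNumer k) : ℤ) : ℚ_[2]) =
        (2 : ℚ_[2]) ^ (2 * k) * ((q : ℤ) : ℚ_[2]) := by
      have := congrArg (fun z : ℤ => (z : ℚ_[2])) hq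
      push_cast at this
      exact this
    rw [hcast, norm_mul, norm_pow, norm_two_padic]
    exact mul_le_of_le_one_right (pow_nonneg (by norm_num) _) (Padic.norm_int_le_one q)
  have h2k : ‖(2 : ℚ_[2])⁻¹ ^ k‖ = (2 : ℝ) ^ k := by
    rw [norm_pow, norm_inv, norm_two_padic, inv_inv]
  rw [kobCoeff, norm_mul, h2k]
  -- `2^k ‖c‖ ≤ 2^k · 2^{-2k} / ‖(m!)²‖ = ‖(m!)²‖⁻¹ 2^{-k}`
  have hcle : ‖((coeff m (kobNumer k) : ℤ) : ℚ_[2])‖ ≤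
      ‖((m.factorial : ℚ_[2])) ^ 2‖⁻¹ * (2⁻¹ : ℝ) ^ (2 * k) := by
    rw [le_inv_mul_iff₀ hfpos]
    exact hc
  calc (2 : ℝ) ^ k * ‖((coeff m (kobNumer k) : ℤ) : ℚ_[2])‖
      ≤ (2 : ℝ) ^ k * (‖((m.factorial : ℚ_[2])) ^ 2‖⁻¹ * (2⁻¹ : ℝ) ^ (2 * k)) :=
        mul_le_mul_of_nonneg_left hcle (pow_nonneg (by norm_num) _)
    _ = ‖((m.factorial : ℚ_[2])) ^ 2‖⁻¹ * (2⁻¹ : ℝ) ^ k := by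
        have key : (2 : ℝ) ^ k * (2⁻¹ : ℝ) ^ (2 * k) = (2⁻¹ : ℝ) ^ k := by
          rw [pow_mul, ← mul_pow]; congr 1; norm_num
        rw [mul_left_comm, key]

/-- **Summability in `k`** of the coefficients `[X^m] t_k(1+X)` in `ℚ₂` (comparison with a
geometric series; `ℚ₂` complete). [cite: Kobayashi2006DocMath, §2 p. 569] -/
theorem summable_kobCoeff (m : ℕ) : Summable fun k => kobCoeff m k := by
  refine Summable.of_norm_bounded (g := fun k => ‖((m.factorial : ℚ_[2])) ^ 2‖⁻¹ * (2⁻¹ : ℝ) ^ k)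
    ?_ (norm_kobCoeff_le m)
  exact (summable_geometric_of_lt_one (by norm_num) (by norm_num)).mul_left _

/-- **`h = ℓ₂ − log(1+X) ∈ ℚ₂⟦X⟧` — Kobayashi's logarithm at `p = 2` minus `log(1+X)`, as the
coefficientwise `2`-adic limit** `[X^m] h := Σ_{k≥0} [X^m] t_k(1+X)` (`tsum` in `ℚ₂`; each sum
converges by `summable_kobCoeff`). The Coleman series of lens-3 (G19.3) would be
`G₂ = e⁴·exp(h)` (not defined here). [cite: Kobayashi2006DocMath, §2 pp. 568–569] -/
noncomputable def kobLogSeries : ℚ_[2]⟦X⟧ :=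
  PowerSeries.mk fun m => ∑' k, kobCoeff m k

/-- The defining `HasSum`: `Σ_k [X^m] t_k(1+X) = [X^m] h`. [cite: Kobayashi2006DocMath, §2 p. 569] -/
theorem hasSum_coeff_kobLogSeries (m : ℕ) :
    HasSum (fun k => kobCoeff m k) (coeff m kobLogSeries) := by
  rw [kobLogSeries, coeff_mk]
  exact (summable_kobCoeff m).hasSum


/-- In `ℚ₂⟦X⟧`: `((1+X)⁻¹)^{2^k}` (the unit inverse) is the base change of the integer series
`((1+X)^{2^k})⁻¹`. [folklore] -/
theorem val_inv_onePlusX_pow (k : ℕ) :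
    ((((onePlusX ℚ_[2])⁻¹ : (ℚ_[2]⟦X⟧)ˣ)) : ℚ_[2]⟦X⟧) ^ 2 ^ k =
      PowerSeries.map (Int.castRingHom ℚ_[2]) (PowerSeries.invOfUnit ((1 + X : ℤ⟦X⟧) ^ 2 ^ k) 1) := by
  have hmap : PowerSeries.map (Int.castRingHom ℚ_[2]) ((1 + X : ℤ⟦X⟧) ^ 2 ^ k) =
      ((onePlusX ℚ_[2] : (ℚ_[2]⟦X⟧)ˣ) : ℚ_[2]⟦X⟧) ^ 2 ^ k := by
    rw [val_onePlusX, map_pow, map_add, map_one, map_X]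
  refine left_inv_eq_right_inv (a := ((onePlusX ℚ_[2] : (ℚ_[2]⟦X⟧)ˣ) : ℚ_[2]⟦X⟧) ^ 2 ^ k) ?_ ?_
  · rw [← mul_pow, ← Units.val_mul, inv_mul_cancel, Units.val_one, one_pow]
  · rw [← hmap, ← map_mul, one_add_X_pow_mul_invOfUnit, map_one]

/- `2` invertible in `ℚ₂⟦X⟧` is taken as an instance HYPOTHESIS of the bridge statements below
(they evaluate the companion file's `kobLog`/`kobTerm` at `u = 1 + X ∈ ℚ₂⟦X⟧ˣ`); no instance is
declared in this file — e.g. `⟨C 2⁻¹, _, _⟩` is one, and `Invertible` is a subsingleton. -/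
variable [Invertible (2 : ℚ_[2]⟦X⟧)]

/-- For ANY `Invertible (2 : ℚ₂⟦X⟧)` instance, `⅟2 = C 2⁻¹` (uniqueness of inverses). [folklore] -/
theorem invOf_two_eq_C : (⅟(2 : ℚ_[2]⟦X⟧)) = C (2 : ℚ_[2])⁻¹ :=
  left_inv_eq_right_inv (invOf_mul_self (2 : ℚ_[2]⟦X⟧))
    (by rw [← map_ofNat (C (R := ℚ_[2])) 2, ← map_mul, mul_inv_cancel₀ two_ne_zero, map_one])

/-- **Bridge to the companion file**: the `k`-th summand `t_k(1+X) ∈ ℚ₂⟦X⟧` of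
`KobayashiTwo.kobLog K (onePlusX ℚ₂)` is `2^{−k}·N_k`. [folklore] -/
theorem kobTerm_onePlusX_eq (k : ℕ) :
    kobTerm (onePlusX ℚ_[2]) k =
      C ((2 : ℚ_[2])⁻¹ ^ k) * PowerSeries.map (Int.castRingHom ℚ_[2]) (kobNumer k) := by
  have hinv : (⅟(2 : ℚ_[2]⟦X⟧)) = C (2 : ℚ_[2])⁻¹ := invOf_two_eq_C
  rw [kobTerm_eq_sq_mul, val_inv_onePlusX_pow, kobNumer, map_mul,
    map_pow (PowerSeries.map (Int.castRingHom ℚ_[2])), map_sub,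
    map_pow (PowerSeries.map (Int.castRingHom ℚ_[2])), map_add, map_one, map_X, val_onePlusX, hinv,
    ← map_pow C]

/-- Coefficientwise: `[X^m] t_k(1+X) = kobCoeff m k`. [folklore] -/
theorem coeff_kobTerm_onePlusX (m k : ℕ) : coeff m (kobTerm (onePlusX ℚ_[2]) k) = kobCoeff m k := by
  rw [kobTerm_onePlusX_eq, coeff_C_mul, coeff_map, kobCoeff, eq_intCast]

/-- The truncations' coefficients are the partial sums: `[X^m] h_K(1+X) = Σ_{k<K} [X^m] t_k(1+X)`.
[folklore] -/
theorem coeff_kobLog_onePlusX (m K : ℕ) :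
    coeff m (kobLog K (onePlusX ℚ_[2])) = ∑ k ∈ Finset.range K, kobCoeff m k := by
  rw [kobLog, map_sum]
  exact Finset.sum_congr rfl fun k _ => coeff_kobTerm_onePlusX m k

/-- **The truncations converge to `h` coefficientwise in `ℚ₂`**:
`[X^m] h_K(1+X) → [X^m] h` as `K → ∞` — the sense in which `h = lim_K h_K` ("convergent in
`ℚ_p⟦X⟧`", [Kobayashi 2006, §2 p. 569], at `p = 2`). [cite: Kobayashi2006DocMath, §2 p. 569] -/
theorem tendsto_coeff_kobLog_onePlusX (m : ℕ) :
    Filter.Tendsto (fun K => coeff m (kobLog K (onePlusX ℚ_[2]))) Filter.atTop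
      (nhds (coeff m kobLogSeries)) := by
  have h := (hasSum_coeff_kobLogSeries m).tendsto_sum_nat
  refine h.congr fun K => ?_
  rw [coeff_kobLog_onePlusX]

end TwoAdic

/-! ## §3. The first coefficients of `h`: `h = −X² + O(X³)` `2`-adically (refuter (k4)) -/

section Coefficients

/-- `[X⁰] t_k = [X¹] t_k = 0` and `[X²] t_k(1+X) = 2^k` in `ℚ₂`. [folklore] -/
theorem kobCoeff_low (k : ℕ) : kobCoeff 0 k = 0 ∧ kobCoeff 1 k = 0 ∧ kobCoeff 2 k = 2 ^ k := by
  obtain ⟨h0, h1, h2⟩ := coeff_kobNumer_low k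
  refine ⟨by simp [kobCoeff, h0], by simp [kobCoeff, h1], ?_⟩
  rw [kobCoeff, h2]
  push_cast
  rw [pow_mul, ← mul_pow, sq, ← mul_assoc, inv_mul_cancel₀ (two_ne_zero : (2 : ℚ_[2]) ≠ 0),
    one_mul]

/-- **`[X⁰] h = 0` and `[X¹] h = 0`** (`h(0) = 0`; `ℓ₂` and `log(1+X)` both have linear term `X`,
[Kobayashi 2006, §2 p. 569] "`ℓ′(X) ∈ 1 + Xℤ_p⟦X⟧, ℓ(0) = 0`"). [cite: Kobayashi2006DocMath, §2 p. 569] -/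
theorem coeff_zero_one_kobLogSeries : coeff 0 kobLogSeries = 0 ∧ coeff 1 kobLogSeries = 0 := by
  have h0 : (fun k => kobCoeff 0 k) = fun _ => 0 := funext fun k => (kobCoeff_low k).1
  have h1 : (fun k => kobCoeff 1 k) = fun _ => 0 := funext fun k => (kobCoeff_low k).2.1
  refine ⟨(hasSum_coeff_kobLogSeries 0).unique ?_, (hasSum_coeff_kobLogSeries 1).unique ?_⟩
  · rw [h0]; exact hasSum_zero
  · rw [h1]; exact hasSum_zero

/-- **`[X²] h = −1` in `ℚ₂`** (refuter §104 (k4): the `X²`-coefficient of `ℓ₂` is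
`−1/2 + Σ_{k≥0} 2^k = −1/2 − 1 = −3/2` `2`-adically, and `[X²] log(1+X) = −1/2`): here
`[X²] t_k(1+X) = 2^k` and `Σ_{k≥0} 2^k = (1 − 2)^{−1} = −1` in `ℚ₂` (`‖2‖₂ = 1/2 < 1`). Over `ℚ`
the same partial sums are `2^K − 1 → ∞`. [folklore] -/
theorem coeff_two_kobLogSeries : coeff 2 kobLogSeries = -1 := by
  have hgeom : HasSum (fun k : ℕ => (2 : ℚ_[2]) ^ k) ((1 - 2)⁻¹) :=
    hasSum_geometric_of_norm_lt_one (by simpa using Padic.norm_p_lt_one (p := 2))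
  have h2 : HasSum (fun k => kobCoeff 2 k) ((1 - 2 : ℚ_[2])⁻¹) := by
    refine hgeom.congr_fun fun k => ?_
    exact (kobCoeff_low k).2.2
  rw [(hasSum_coeff_kobLogSeries 2).unique h2]
  norm_num

end Coefficients

end KobayashiTwo

end Summit.BirchSwinnertonDyer.Rank1Residual.X5.O1
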